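import Mathlib
import Summits.NavierStokesRegularity.NavierStokesRegularity.Theorems.TaoLadderRungTwoBreakBlowupRigidityOnePinnedExtraction
import HarnessLib

/-!
# THE TWO-SIDED CLOCK IS FREE: re-selected firing times from type I + amplitude ceiling + firing floor, and the
  extraction from the FOUR-ITEM pinning bundle (type I, action ceiling, amplitude ceiling `B ν^k`, firing floor) —
  the ν = 0 twin of route WakeRatchet's `Pinned` class, for the stub `stub_eternalFromBlowup` of K2(1)
  `TaoLadderRungTwoBreak.BlowupRigidityOne` (stmt-NavierStokesRegularity-20206)

MODEL lattice ODEs only (Tao 2016 §4 (4.8)/(4.12), §6.4); nothing here is a statement about the Navier–Stokes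
equations; NO item is closed (`--supports stmt-NavierStokesRegularity-20206`). Route-independent (general `m`; `m = 4`
only in the stub-shaped corollary).

`survivingEternalLimit_of_pinned` (previous file) asked, besides type I and the ceilings, for firing times carrying a
floor AND a two-sided self-similar clock. As in the viscous kit ⟨22744⟩ (`…ClockedFrames.stubClock_holds`), the clock
costs nothing: the UPPER clock is type I at a floor time, and the LOWER clock is obtained by RE-SELECTING the firing
time slightly earlier, using a Lipschitz bound for the shell energies that follows from the exact law and the
amplitude ceiling (`hasDerivWithinAt_energy`, `abs_energyDeriv_le`, `energy_lipschitz`). Hence: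

* `clock_of_pinning` — floor `c_f (ν²)^k ≤ ‖x_k(t_k)‖²` somewhere on `[0,T)` for every `k ∈ ℕ` + type I + amplitude
  ceiling `‖x_j‖ ≤ B ν^j` + `Λν ≥ 1` ⇒ re-selected firing times with floor `c_f/2` and clock
  `c₀² ≤ (Λ²ν²)^k (T-τ_k)² ≤ 2C²/c_f`;
* `eternal_surviving_one_of_fourPinned` — **the extraction from the four-item bundle** at `a = 1`
  (`(1+ε₀)⁻¹ ≤ ν²`): `∃ W, IsEternal ε₀ α W ∧ UniformBound W ∧ EternalSurvivingFwd 1 ε₀ W`;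
* `stub_eternalFromBlowup_of_fourPinnedBlowups` — the REGISTERED STUB SIGNATURE verbatim from the four-item bundle
  attached to every robust blow-up below threshold (the exact ν = 0 analogue of WakeRatchet's open crux
  `MinimalViscousBlowup` ⟨22743⟩ feeding its PROVED extraction ⟨22744⟩).

HONEST LABEL: the four-item bundle is OPEN for robust inviscid blow-up of a fixed-spread table (type I = N-39; action
ceiling, amplitude ceiling and firing floor at a common surviving ratio = asymptotic self-similarity, (E2)); this file
only shrinks the hypothesis list of the previous file. `stub_eternalIsDSS` untouched. No stub, crux or summit is proved.
-/

noncomputable section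

-- the summit and its single sub-problem share the name (CONVENTIONS §1)
set_option linter.dupNamespace false

open Set Filter Topology MeasureTheory
open scoped RealInnerProductSpace

namespace Summit.NavierStokesRegularity.NavierStokesRegularity.Theorems

namespace BlowupRigidityOne

open Literature.Analysis.FluidPDE Literature.Analysis.FluidPDE.TaoCascade

variable {m : ℕ}

/-- **The shell energy of an exact flow is differentiable on `[0,T)`** (one-sided at `0`), with derivative
`2⟪x_k, Λ^k (Q(x_k) + Λ⁻¹ A(x_{k-1}) + B(x_{k+1}, x_k))⟫`. [cite: Tao2016AveragedNS, §4 (4.8)–(4.9), (4.12)] -/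
theorem hasDerivWithinAt_energy {ε₀ T : ℝ} (hε : 0 < ε₀) {α : Fin m → Fin m → Fin m → ℤ × ℤ × ℤ → ℝ}
    {X : Fin m → ℤ → ℝ → ℝ} (hC1 : ∀ i n, ContDiffOn ℝ 1 (X i n) (Set.Ico 0 T))
    (hmot : ∀ i n t, 0 ≤ t → t < T → derivWithin (X i n) (Set.Ici 0) t = quadTerm ε₀ α X i n t)
    (k : ℤ) {τ : ℝ} (hτ : τ ∈ Ico 0 T) :
    HasDerivWithinAt (fun t => ‖shellVec X k t‖ ^ 2)
      (2 * ⟪shellVec X k τ, bigLam ε₀ ^ k • (tableQ α (shellVec X k τ)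
        + (bigLam ε₀)⁻¹ • tableA α (shellVec X (k - 1) τ)
        + tableB α (shellVec X (k + 1) τ) (shellVec X k τ))⟫) (Ico 0 T) τ := by
  have hcomp : ∀ i, HasDerivWithinAt (X i k) (quadTerm ε₀ α X i k τ) (Ico 0 T) τ := by
    intro i
    have hd : DifferentiableWithinAt ℝ (X i k) (Ico 0 T) τ :=
      ((hC1 i k).differentiableOn one_ne_zero) τ hτ
    have hnhds : Ico 0 T ∈ 𝓝[Ici 0] τ := by
      rw [mem_nhdsWithin]
      exact ⟨Iio T, isOpen_Iio, hτ.2, fun x hx => ⟨hx.2, hx.1⟩⟩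
    have hd' : DifferentiableWithinAt ℝ (X i k) (Ici 0) τ := hd.mono_of_mem_nhdsWithin hnhds
    have h1 : HasDerivWithinAt (X i k) (derivWithin (X i k) (Ici 0) τ) (Ici 0) τ := hd'.hasDerivWithinAt
    rw [hmot i k τ hτ.1 hτ.2] at h1
    exact h1.mono fun x hx => hx.1
  have hv := DSSOneShift.hasDerivWithinAt_shellVec hcomp
  have heq : (WithLp.toLp 2 fun i => quadTerm ε₀ α X i k τ : Em m) =
      shellVec (fun i n s => quadTerm ε₀ α X i n s) k τ := rfl
  rw [heq, DSSOneShift.shellVec_quadTerm_normalForm (by linarith) α X k τ] at hv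
  exact hv.norm_sq

/-- **The energy derivative under an amplitude ceiling.** If `‖x‖ ≤ B ν^k`, `‖y‖ ≤ B ν^k ν⁻¹`, `‖z‖ ≤ B ν^k ν` (the
amplitude ceiling at ratio `ν` on the shells `k, k-1, k+1`), then
`|2⟪x, Λ^k(Q(x) + Λ⁻¹A(y) + B(z,x))⟫| ≤ 2B³ (s₀₀₀ + Λ⁻¹ s₀₀₁ ν⁻² + (s₁₀₀+s₀₁₀) ν) · (Λν³)^k`.
[cite: Tao2016AveragedNS, §4 (4.1), (4.8)–(4.9); cell vocabulary (`shiftConst`)] -/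
theorem abs_energyDeriv_le {ε₀ : ℝ} (hε : 0 < ε₀) (α : Fin m → Fin m → Fin m → ℤ × ℤ × ℤ → ℝ) {B ν : ℝ}
    (hB : 0 ≤ B) (hν : 0 < ν) {x y z : Em m} {k : ℕ}
    (hx : ‖x‖ ≤ B * ν ^ k) (hy : ‖y‖ ≤ B * (ν ^ k * ν⁻¹)) (hz : ‖z‖ ≤ B * (ν ^ k * ν)) :
    |2 * ⟪x, bigLam ε₀ ^ (k : ℤ) • (tableQ α x + (bigLam ε₀)⁻¹ • tableA α y + tableB α z x)⟫| ≤
      (2 * B ^ 3 * (shiftConst α (0, 0, 0) + (bigLam ε₀)⁻¹ * shiftConst α (0, 0, 1) * ν⁻¹ ^ 2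
        + (shiftConst α (1, 0, 0) + shiftConst α (0, 1, 0)) * ν)) * (bigLam ε₀ * ν ^ 3) ^ k := by
  have hΛ : 0 < bigLam ε₀ := bigLam_pos (by linarith)
  have hx0 : 0 ≤ B * ν ^ k := (norm_nonneg _).trans hx
  have s0 := shiftConst_nonneg α (0, 0, 0)
  have s1 := shiftConst_nonneg α (0, 0, 1)
  have sB : 0 ≤ shiftConst α (1, 0, 0) + shiftConst α (0, 1, 0) :=
    add_nonneg (shiftConst_nonneg α _) (shiftConst_nonneg α _)
  -- the three pieces of the field
  have hQ : ‖tableQ α x‖ ≤ shiftConst α (0, 0, 0) * (B * ν ^ k) ^ 2 :=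
    (norm_tableQ_le α x).trans (mul_le_mul_of_nonneg_left (pow_le_pow_left₀ (norm_nonneg _) hx 2) s0)
  have hA : ‖(bigLam ε₀)⁻¹ • tableA α y‖ ≤ (bigLam ε₀)⁻¹ * (shiftConst α (0, 0, 1) * (B * (ν ^ k * ν⁻¹)) ^ 2) := by
    rw [norm_smul, Real.norm_of_nonneg (inv_pos.2 hΛ).le]
    exact mul_le_mul_of_nonneg_left ((norm_tableA_le α y).trans
      (mul_le_mul_of_nonneg_left (pow_le_pow_left₀ (norm_nonneg _) hy 2) s1)) (inv_pos.2 hΛ).le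
  have hBz : ‖tableB α z x‖ ≤ (shiftConst α (1, 0, 0) + shiftConst α (0, 1, 0)) * (B * (ν ^ k * ν)) * (B * ν ^ k) :=
    (norm_tableB_le α z x).trans (mul_le_mul (mul_le_mul_of_nonneg_left hz sB) hx (norm_nonneg _)
      (mul_nonneg sB ((norm_nonneg _).trans hz)))
  have hsum : ‖tableQ α x + (bigLam ε₀)⁻¹ • tableA α y + tableB α z x‖ ≤
      shiftConst α (0, 0, 0) * (B * ν ^ k) ^ 2
        + (bigLam ε₀)⁻¹ * (shiftConst α (0, 0, 1) * (B * (ν ^ k * ν⁻¹)) ^ 2)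
        + (shiftConst α (1, 0, 0) + shiftConst α (0, 1, 0)) * (B * (ν ^ k * ν)) * (B * ν ^ k) :=
    (norm_add_le _ _).trans (add_le_add ((norm_add_le _ _).trans (add_le_add hQ hA)) hBz)
  have hS0 : 0 ≤ shiftConst α (0, 0, 0) * (B * ν ^ k) ^ 2
      + (bigLam ε₀)⁻¹ * (shiftConst α (0, 0, 1) * (B * (ν ^ k * ν⁻¹)) ^ 2)
      + (shiftConst α (1, 0, 0) + shiftConst α (0, 1, 0)) * (B * (ν ^ k * ν)) * (B * ν ^ k) := by positivity
  -- Cauchy–Schwarz and the scalar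
  have hcs := abs_real_inner_le_norm x
    (bigLam ε₀ ^ (k : ℤ) • (tableQ α x + (bigLam ε₀)⁻¹ • tableA α y + tableB α z x))
  rw [zpow_natCast, norm_smul, Real.norm_of_nonneg (pow_pos hΛ k).le] at hcs
  rw [abs_mul, abs_two]
  have key : ‖x‖ * (bigLam ε₀ ^ k * ‖tableQ α x + (bigLam ε₀)⁻¹ • tableA α y + tableB α z x‖) ≤
      (B * ν ^ k) * (bigLam ε₀ ^ k * (shiftConst α (0, 0, 0) * (B * ν ^ k) ^ 2
        + (bigLam ε₀)⁻¹ * (shiftConst α (0, 0, 1) * (B * (ν ^ k * ν⁻¹)) ^ 2)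
        + (shiftConst α (1, 0, 0) + shiftConst α (0, 1, 0)) * (B * (ν ^ k * ν)) * (B * ν ^ k))) :=
    mul_le_mul hx (mul_le_mul_of_nonneg_left hsum (pow_pos hΛ k).le) (by positivity) hx0
  have halg : (B * ν ^ k) * (bigLam ε₀ ^ k * (shiftConst α (0, 0, 0) * (B * ν ^ k) ^ 2
        + (bigLam ε₀)⁻¹ * (shiftConst α (0, 0, 1) * (B * (ν ^ k * ν⁻¹)) ^ 2)
        + (shiftConst α (1, 0, 0) + shiftConst α (0, 1, 0)) * (B * (ν ^ k * ν)) * (B * ν ^ k))) =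
      B ^ 3 * (shiftConst α (0, 0, 0) + (bigLam ε₀)⁻¹ * shiftConst α (0, 0, 1) * ν⁻¹ ^ 2
        + (shiftConst α (1, 0, 0) + shiftConst α (0, 1, 0)) * ν) * (bigLam ε₀ * ν ^ 3) ^ k := by
    rw [mul_pow (bigLam ε₀) (ν ^ 3) k, ← pow_mul]
    ring
  calc 2 * |⟪x, bigLam ε₀ ^ (k : ℤ) • (tableQ α x + (bigLam ε₀)⁻¹ • tableA α y + tableB α z x)⟫|
      ≤ 2 * (‖x‖ * (bigLam ε₀ ^ k * ‖tableQ α x + (bigLam ε₀)⁻¹ • tableA α y + tableB α z x‖)) :=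
        mul_le_mul_of_nonneg_left hcs zero_le_two
    _ ≤ 2 * (B ^ 3 * (shiftConst α (0, 0, 0) + (bigLam ε₀)⁻¹ * shiftConst α (0, 0, 1) * ν⁻¹ ^ 2
        + (shiftConst α (1, 0, 0) + shiftConst α (0, 1, 0)) * ν) * (bigLam ε₀ * ν ^ 3) ^ k) := by
        rw [← halg]; exact mul_le_mul_of_nonneg_left key zero_le_two
    _ = _ := by ring

/-- **ENERGY LIPSCHITZ BOUND under the amplitude ceiling.** For an exact flow on `[0,T)` with `‖x_j(t)‖ ≤ B ν^j`
(all `j ∈ ℤ`, `0 ≤ t < T`), every shell energy `‖x_k(·)‖²` (`k ∈ ℕ`) is Lipschitz on `[0,T)` with constant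
`K · (Λν³)^k`, `K = 2B³ (s₀₀₀ + Λ⁻¹ s₀₀₁ ν⁻² + (s₁₀₀+s₀₁₀) ν)`. [cite: Tao2016AveragedNS, §4 (4.8)–(4.9), (4.12)] -/
theorem energy_lipschitz {ε₀ T B ν : ℝ} (hε : 0 < ε₀) {α : Fin m → Fin m → Fin m → ℤ × ℤ × ℤ → ℝ}
    {X : Fin m → ℤ → ℝ → ℝ} (hC1 : ∀ i n, ContDiffOn ℝ 1 (X i n) (Set.Ico 0 T))
    (hmot : ∀ i n t, 0 ≤ t → t < T → derivWithin (X i n) (Set.Ici 0) t = quadTerm ε₀ α X i n t)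
    (hB : 0 ≤ B) (hν : 0 < ν)
    (hamp : ∀ (j : ℤ) (t : ℝ), 0 ≤ t → t < T → ‖shellVec X j t‖ ≤ B * ν ^ j)
    (k : ℕ) {s t : ℝ} (hs : s ∈ Ico 0 T) (ht : t ∈ Ico 0 T) :
    |‖shellVec X (k : ℤ) t‖ ^ 2 - ‖shellVec X (k : ℤ) s‖ ^ 2| ≤
      (2 * B ^ 3 * (shiftConst α (0, 0, 0) + (bigLam ε₀)⁻¹ * shiftConst α (0, 0, 1) * ν⁻¹ ^ 2
        + (shiftConst α (1, 0, 0) + shiftConst α (0, 1, 0)) * ν)) * (bigLam ε₀ * ν ^ 3) ^ k * |t - s| := by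
  have hk1 : ∀ u : ℝ, 0 ≤ u → u < T → ‖shellVec X ((k : ℤ) - 1) u‖ ≤ B * (ν ^ k * ν⁻¹) := by
    intro u hu0 huT
    have h := hamp ((k : ℤ) - 1) u hu0 huT
    rwa [zpow_sub_one₀ hν.ne', zpow_natCast] at h
  have hk2 : ∀ u : ℝ, 0 ≤ u → u < T → ‖shellVec X ((k : ℤ) + 1) u‖ ≤ B * (ν ^ k * ν) := by
    intro u hu0 huT
    have h := hamp ((k : ℤ) + 1) u hu0 huT
    rwa [zpow_add_one₀ hν.ne', zpow_natCast] at h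
  have hk0 : ∀ u : ℝ, 0 ≤ u → u < T → ‖shellVec X (k : ℤ) u‖ ≤ B * ν ^ k := by
    intro u hu0 huT
    have h := hamp (k : ℤ) u hu0 huT
    rwa [zpow_natCast] at h
  have h := Convex.norm_image_sub_le_of_norm_hasDerivWithin_le
    (f := fun u => ‖shellVec X (k : ℤ) u‖ ^ 2) (s := Ico 0 T) (x := s) (y := t)
    (fun u hu => hasDerivWithinAt_energy hε hC1 hmot (k : ℤ) hu)
    (fun u hu => by
      rw [Real.norm_eq_abs]
      exact abs_energyDeriv_le hε α hB hν (hk0 u hu.1 hu.2) (hk1 u hu.1 hu.2) (hk2 u hu.1 hu.2))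
    (convex_Ico 0 T) hs ht
  rw [Real.norm_eq_abs, Real.norm_eq_abs] at h
  exact h

/-- **THE TWO-SIDED CLOCK BY RE-SELECTION.** Let `X` be an exact flow on `[0,T)` (`T > 0`) with TYPE I
(`Λ^n(T-t)‖x_n(t)‖ ≤ C`), the AMPLITUDE CEILING `‖x_j(t)‖ ≤ B ν^j` (`ν > 0`, `Λν ≥ 1`) and, for every shell `k ∈ ℕ`,
a time in `[0,T)` where the FLOOR `c_f (ν²)^k ≤ ‖x_k‖²` holds. Then there are RE-SELECTED firing times `τ_k ∈ [0,T)`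
with floor `c_f/2 · (ν²)^k ≤ ‖x_k(τ_k)‖²` and the two-sided self-similar clock `κ₁ ≤ (Λ²ν²)^k (T-τ_k)² ≤ κ₂`
(`κ₁ = c₀²`, `c₀ = min(c_f/(2K), T)`, `K` the energy-Lipschitz constant `+1`; `κ₂ = 2C²/c_f + 1`): pull the given
time back by `c₀ (Λν)^{-k}` (the energy moves by at most `c_f/2 · (ν²)^k`, `energy_lipschitz`) for the lower clock;
type I at the new time for the upper clock. The ν = 0, general-ratio twin of `…ClockedFrames.stubClock_holds` (⟨22744⟩).
[cite: Tao2016AveragedNS, §4 (4.8)–(4.10), §6.4; cell vocabulary] -/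
theorem clock_of_pinning {ε₀ T C B ν cf : ℝ} (hε : 0 < ε₀) (hT : 0 < T)
    {α : Fin m → Fin m → Fin m → ℤ × ℤ × ℤ → ℝ}
    {X : Fin m → ℤ → ℝ → ℝ} (hC1 : ∀ i n, ContDiffOn ℝ 1 (X i n) (Set.Ico 0 T))
    (hmot : ∀ i n t, 0 ≤ t → t < T → derivWithin (X i n) (Set.Ici 0) t = quadTerm ε₀ α X i n t)
    (htypeI : ∀ (n : ℤ) (t : ℝ), 0 ≤ t → t < T → bigLam ε₀ ^ n * (T - t) * ‖shellVec X n t‖ ≤ C)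
    (hB : 0 ≤ B) (hν : 0 < ν)
    (hamp : ∀ (j : ℤ) (t : ℝ), 0 ≤ t → t < T → ‖shellVec X j t‖ ≤ B * ν ^ j)
    (hΛν : 1 ≤ bigLam ε₀ * ν) (hcf : 0 < cf)
    (hfire : ∀ k : ℕ, ∃ t : ℝ, 0 ≤ t ∧ t < T ∧ cf * (ν ^ 2) ^ k ≤ ‖shellVec X (k : ℤ) t‖ ^ 2) :
    ∃ (κ₁ κ₂ : ℝ) (τ : ℕ → ℝ), 0 < κ₁ ∧ 0 < κ₂ ∧ (∀ k : ℕ, 0 ≤ τ k ∧ τ k < T) ∧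
      (∀ k : ℕ, cf / 2 * (ν ^ 2) ^ k ≤ ‖shellVec X (k : ℤ) (τ k)‖ ^ 2) ∧
      (∀ k : ℕ, κ₁ ≤ (bigLam ε₀ ^ 2 * ν ^ 2) ^ k * (T - τ k) ^ 2) ∧
      (∀ k : ℕ, (bigLam ε₀ ^ 2 * ν ^ 2) ^ k * (T - τ k) ^ 2 ≤ κ₂) := by
  have hΛ : 0 < bigLam ε₀ := bigLam_pos (by linarith)
  have s0 := shiftConst_nonneg α (0, 0, 0)
  have s1 := shiftConst_nonneg α (0, 0, 1)
  have sB : 0 ≤ shiftConst α (1, 0, 0) + shiftConst α (0, 1, 0) :=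
    add_nonneg (shiftConst_nonneg α _) (shiftConst_nonneg α _)
  have hΛi : 0 ≤ (bigLam ε₀)⁻¹ := (inv_pos.2 hΛ).le
  -- the energy-Lipschitz constant (`+1` keeps it positive)
  set K : ℝ := 2 * B ^ 3 * (shiftConst α (0, 0, 0) + (bigLam ε₀)⁻¹ * shiftConst α (0, 0, 1) * ν⁻¹ ^ 2
    + (shiftConst α (1, 0, 0) + shiftConst α (0, 1, 0)) * ν) + 1 with hK_def
  have hK1 : 2 * B ^ 3 * (shiftConst α (0, 0, 0) + (bigLam ε₀)⁻¹ * shiftConst α (0, 0, 1) * ν⁻¹ ^ 2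
      + (shiftConst α (1, 0, 0) + shiftConst α (0, 1, 0)) * ν) ≤ K := by rw [hK_def]; linarith
  have hK0 : 0 < K := by
    have : 0 ≤ 2 * B ^ 3 * (shiftConst α (0, 0, 0) + (bigLam ε₀)⁻¹ * shiftConst α (0, 0, 1) * ν⁻¹ ^ 2
        + (shiftConst α (1, 0, 0) + shiftConst α (0, 1, 0)) * ν) := by positivity
    rw [hK_def]; linarith
  set ρ : ℝ := bigLam ε₀ * ν with hρ_def
  have hρ : 0 < ρ := by positivity
  have hρk : ∀ k : ℕ, 1 ≤ ρ ^ k := fun k => one_le_pow₀ hΛν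
  set c₀ : ℝ := min (cf / (2 * K)) T with hc₀_def
  have hc₀ : 0 < c₀ := lt_min (by positivity) hT
  have hc₀K : c₀ ≤ cf / (2 * K) := min_le_left _ _
  have hc₀T : c₀ ≤ T := min_le_right _ _
  -- original floor times, pulled back by `δ_k = c₀ (Λν)^{-k}`
  choose tf htf using hfire
  have hδ : ∀ k : ℕ, 0 < c₀ * (ρ ^ k)⁻¹ := fun k => by positivity
  have hδle : ∀ k : ℕ, c₀ * (ρ ^ k)⁻¹ ≤ c₀ := fun k => by
    have : (ρ ^ k)⁻¹ ≤ 1 := inv_le_one_of_one_le₀ (hρk k)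
    calc c₀ * (ρ ^ k)⁻¹ ≤ c₀ * 1 := mul_le_mul_of_nonneg_left this hc₀.le
      _ = c₀ := mul_one _
  refine ⟨c₀ ^ 2, 2 * C ^ 2 / cf + 1, fun k => max (tf k - c₀ * (ρ ^ k)⁻¹) 0, by positivity, by positivity,
    ?_⟩
  -- per-shell facts
  have key : ∀ k : ℕ, (0 ≤ max (tf k - c₀ * (ρ ^ k)⁻¹) 0 ∧ max (tf k - c₀ * (ρ ^ k)⁻¹) 0 < T) ∧
      cf / 2 * (ν ^ 2) ^ k ≤ ‖shellVec X (k : ℤ) (max (tf k - c₀ * (ρ ^ k)⁻¹) 0)‖ ^ 2 ∧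
      c₀ ^ 2 ≤ (bigLam ε₀ ^ 2 * ν ^ 2) ^ k * (T - max (tf k - c₀ * (ρ ^ k)⁻¹) 0) ^ 2 ∧
      (bigLam ε₀ ^ 2 * ν ^ 2) ^ k * (T - max (tf k - c₀ * (ρ ^ k)⁻¹) 0) ^ 2 ≤ 2 * C ^ 2 / cf + 1 := by
    intro k
    obtain ⟨ht0, htT, hfl⟩ := htf k
    set τ := max (tf k - c₀ * (ρ ^ k)⁻¹) 0 with hτ_def
    have hτ0 : 0 ≤ τ := le_max_right _ _
    have hτle : τ ≤ tf k := max_le (by linarith [hδ k]) ht0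
    have hτT : τ < T := lt_of_le_of_lt hτle htT
    have hgap : tf k - τ ≤ c₀ * (ρ ^ k)⁻¹ := by
      have h := le_max_left (tf k - c₀ * (ρ ^ k)⁻¹) 0
      linarith
    have hq : (bigLam ε₀ ^ 2 * ν ^ 2) ^ k = (ρ ^ k) ^ 2 := by
      rw [hρ_def, ← mul_pow, ← pow_mul, ← pow_mul, Nat.mul_comm]
    -- the floor survives the pull-back
    have hLip := energy_lipschitz hε hC1 hmot hB hν hamp k (s := τ) (t := tf k) ⟨hτ0, hτT⟩ ⟨ht0, htT⟩
    have hfloor : cf / 2 * (ν ^ 2) ^ k ≤ ‖shellVec X (k : ℤ) τ‖ ^ 2 := by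
      have h1 : ‖shellVec X (k : ℤ) (tf k)‖ ^ 2 - ‖shellVec X (k : ℤ) τ‖ ^ 2 ≤
          K * (bigLam ε₀ * ν ^ 3) ^ k * (c₀ * (ρ ^ k)⁻¹) := by
        rw [abs_of_nonneg (by linarith : 0 ≤ tf k - τ)] at hLip
        calc ‖shellVec X (k : ℤ) (tf k)‖ ^ 2 - ‖shellVec X (k : ℤ) τ‖ ^ 2
            ≤ (2 * B ^ 3 * (shiftConst α (0, 0, 0) + (bigLam ε₀)⁻¹ * shiftConst α (0, 0, 1) * ν⁻¹ ^ 2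
              + (shiftConst α (1, 0, 0) + shiftConst α (0, 1, 0)) * ν)) * (bigLam ε₀ * ν ^ 3) ^ k * (tf k - τ) :=
              (le_abs_self _).trans hLip
          _ ≤ K * (bigLam ε₀ * ν ^ 3) ^ k * (c₀ * (ρ ^ k)⁻¹) :=
              mul_le_mul (mul_le_mul_of_nonneg_right hK1 (by positivity)) hgap (by linarith) (by positivity)
      have h2 : K * (bigLam ε₀ * ν ^ 3) ^ k * (c₀ * (ρ ^ k)⁻¹) = K * c₀ * (ν ^ 2) ^ k := by
        rw [hρ_def]
        have hρk0 : (bigLam ε₀ * ν) ^ k ≠ 0 := (pow_pos hρ k).ne'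
        rw [show (bigLam ε₀ * ν ^ 3) ^ k = (bigLam ε₀ * ν) ^ k * (ν ^ 2) ^ k by
          rw [← mul_pow]; ring]
        field_simp
      have h3 : K * c₀ * (ν ^ 2) ^ k ≤ cf / 2 * (ν ^ 2) ^ k := by
        refine mul_le_mul_of_nonneg_right ?_ (by positivity)
        calc K * c₀ ≤ K * (cf / (2 * K)) := mul_le_mul_of_nonneg_left hc₀K hK0.le
          _ = cf / 2 := by field_simp
      linarith
    -- the lower clock: `T - τ ≥ δ_k`
    have hlow : c₀ * (ρ ^ k)⁻¹ ≤ T - τ := by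
      rcases le_total (tf k - c₀ * (ρ ^ k)⁻¹) 0 with h | h
      · have hτeq : τ = 0 := by rw [hτ_def]; exact max_eq_right h
        rw [hτeq, sub_zero]
        exact (hδle k).trans hc₀T
      · have hτeq : τ = tf k - c₀ * (ρ ^ k)⁻¹ := by rw [hτ_def]; exact max_eq_left h
        rw [hτeq]
        linarith
    have hclock₁ : c₀ ^ 2 ≤ (bigLam ε₀ ^ 2 * ν ^ 2) ^ k * (T - τ) ^ 2 := by
      rw [hq]
      have h1 : c₀ ≤ ρ ^ k * (T - τ) := by
        have h := mul_le_mul_of_nonneg_left hlow (pow_pos hρ k).le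
        have e : ρ ^ k * (c₀ * (ρ ^ k)⁻¹) = c₀ := by field_simp
        rwa [e] at h
      calc c₀ ^ 2 ≤ (ρ ^ k * (T - τ)) ^ 2 := pow_le_pow_left₀ hc₀.le h1 2
        _ = (ρ ^ k) ^ 2 * (T - τ) ^ 2 := by ring
    -- the upper clock: type I at `τ` against the floor
    have hclock₂ : (bigLam ε₀ ^ 2 * ν ^ 2) ^ k * (T - τ) ^ 2 ≤ 2 * C ^ 2 / cf + 1 := by
      have hI := htypeI (k : ℤ) τ hτ0 hτT
      rw [zpow_natCast] at hI
      have hLnn : 0 ≤ bigLam ε₀ ^ k * (T - τ) * ‖shellVec X (k : ℤ) τ‖ :=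
        mul_nonneg (mul_nonneg (pow_pos hΛ k).le (by linarith)) (norm_nonneg _)
      have h1 : (bigLam ε₀ ^ 2 * ν ^ 2) ^ k * (T - τ) ^ 2 * (cf / 2) ≤ C ^ 2 := by
        calc (bigLam ε₀ ^ 2 * ν ^ 2) ^ k * (T - τ) ^ 2 * (cf / 2)
            = (bigLam ε₀ ^ k * (T - τ)) ^ 2 * (cf / 2 * (ν ^ 2) ^ k) := by rw [mul_pow, ← pow_mul, ← pow_mul]; ring
          _ ≤ (bigLam ε₀ ^ k * (T - τ)) ^ 2 * ‖shellVec X (k : ℤ) τ‖ ^ 2 :=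
              mul_le_mul_of_nonneg_left hfloor (sq_nonneg _)
          _ = (bigLam ε₀ ^ k * (T - τ) * ‖shellVec X (k : ℤ) τ‖) ^ 2 := by ring
          _ ≤ C ^ 2 := pow_le_pow_left₀ hLnn hI 2
      have h2 : (bigLam ε₀ ^ 2 * ν ^ 2) ^ k * (T - τ) ^ 2 ≤ 2 * C ^ 2 / cf := by
        rw [le_div_iff₀ hcf]; linarith
      linarith
    exact ⟨⟨hτ0, hτT⟩, hfloor, hclock₁, hclock₂⟩
  exact ⟨fun k => (key k).1, fun k => (key k).2.1, fun k => (key k).2.2.1, fun k => (key k).2.2.2⟩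

/-- `(ν^j)² = (ν²)^j` for integer `j`. [folklore] -/
theorem zpow_sq_comm (ν : ℝ) (j : ℤ) : (ν ^ j) ^ 2 = (ν ^ 2) ^ j := by
  rw [← zpow_natCast (ν ^ j) 2, ← zpow_mul, ← zpow_natCast ν 2, ← zpow_mul, mul_comm]

/-- **THE EXTRACTION FROM THE FOUR-ITEM PINNING BUNDLE (a = 1).** An exact flow on `[0,T)` of the table `α` that is
TYPE I, has a per-shell ACTION CEILING, an AMPLITUDE CEILING `‖x_j(t)‖ ≤ B ν^j` at an (S₁)-surviving ratio
`(1+ε₀)⁻¹ ≤ ν²`, and a FIRING FLOOR `c_f (ν²)^k ≤ ‖x_k(t_k)‖²` somewhere on `[0,T)` for every `k ∈ ℕ`, has an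
admissible, uniformly bounded eternal ω-limit that is (S₁)-surviving forward:
`∃ W, IsEternal ε₀ α W ∧ UniformBound W ∧ EternalSurvivingFwd 1 ε₀ W` (`clock_of_pinning` + `eternal_surviving_one_of_pinned`).
[cite: Tao2016AveragedNS, §4 Thm. 4.2 (statement shape), (4.8)–(4.10), §6.4; KochNadirashviliSereginSverak2009, Thm 1.1 ff.; cell vocabulary] -/
theorem eternal_surviving_one_of_fourPinned {ε₀ T C A B ν cf : ℝ} (hε : 0 < ε₀) (hT : 0 < T)
    {α : Fin m → Fin m → Fin m → ℤ × ℤ × ℤ → ℝ}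
    {X : Fin m → ℤ → ℝ → ℝ} (hC1 : ∀ i n, ContDiffOn ℝ 1 (X i n) (Set.Ico 0 T))
    (hmot : ∀ i n t, 0 ≤ t → t < T → derivWithin (X i n) (Set.Ici 0) t = quadTerm ε₀ α X i n t)
    (htypeI : ∀ (n : ℤ) (t : ℝ), 0 ≤ t → t < T → bigLam ε₀ ^ n * (T - t) * ‖shellVec X n t‖ ≤ C)
    (hact : ∀ k : ℤ, IntegrableOn (fun t => ‖shellVec X k t‖) (Ico 0 T) ∧
      bigLam ε₀ ^ k * (∫ t in Ico 0 T, ‖shellVec X k t‖) ≤ A)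
    (hν : 0 < ν) (hν1 : (1 + ε₀)⁻¹ ≤ ν ^ 2)
    (hamp : ∀ (j : ℤ) (t : ℝ), 0 ≤ t → t < T → ‖shellVec X j t‖ ≤ B * ν ^ j)
    (hcf : 0 < cf)
    (hfire : ∀ k : ℕ, ∃ t : ℝ, 0 ≤ t ∧ t < T ∧ cf * (ν ^ 2) ^ k ≤ ‖shellVec X (k : ℤ) t‖ ^ 2) :
    ∃ Wlim : ℤ → ℝ → Em m, IsEternal ε₀ α Wlim ∧ UniformBound Wlim ∧ EternalSurvivingFwd 1 ε₀ Wlim := by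
  have hb : (0 : ℝ) < 1 + ε₀ := by linarith
  have hΛ : 0 < bigLam ε₀ := bigLam_pos (by linarith)
  have hB : 0 ≤ B := by
    have h := hamp 0 0 le_rfl hT
    rw [zpow_zero, mul_one] at h
    exact (norm_nonneg _).trans h
  -- `Λν ≥ 1` from `Λ²ν² ≥ (1+ε₀)^4 ≥ 1`
  have hΛν : 1 ≤ bigLam ε₀ * ν := by
    have h2 : 1 ≤ (bigLam ε₀ * ν) ^ 2 := by
      rw [mul_pow, bigLam_sq hε]
      have h4 : (1 : ℝ) ≤ (1 + ε₀) ^ 4 := one_le_pow₀ (by linarith)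
      calc (1 : ℝ) ≤ (1 + ε₀) ^ 4 := h4
        _ = (1 + ε₀) ^ 5 * (1 + ε₀)⁻¹ := by field_simp
        _ ≤ (1 + ε₀) ^ 5 * ν ^ 2 := mul_le_mul_of_nonneg_left hν1 (pow_pos hb 5).le
    by_contra h
    push Not at h
    have : (bigLam ε₀ * ν) ^ 2 < 1 := pow_lt_one₀ (by positivity) h two_ne_zero
    linarith
  -- energy ceiling at ratio `μ = ν²`
  have hE : ∀ (k : ℤ) (t : ℝ), 0 ≤ t → t < T → ‖shellVec X k t‖ ^ 2 ≤ B ^ 2 * (ν ^ 2) ^ k := by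
    intro k t ht0 htT
    have h := pow_le_pow_left₀ (norm_nonneg _) (hamp k t ht0 htT) 2
    rwa [mul_pow, zpow_sq_comm] at h
  obtain ⟨κ₁, κ₂, τ, hκ₁, hκ₂, hτ, hfloor, hclock₁, hclock₂⟩ :=
    clock_of_pinning hε hT hC1 hmot htypeI hB hν hamp hΛν hcf hfire
  exact eternal_surviving_one_of_pinned hε hT hC1 hmot htypeI hact hν1 hE hτ hfloor hclock₁ hclock₂
    (by positivity) hκ₁ hκ₂

/-- **THE REGISTERED STUB `stub_eternalFromBlowup` MODULO THE FOUR-ITEM BUNDLE.** If below a threshold `ε_s(R)` every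
robust blow-up (`NoGlobalCascade ε₀ α X₀`) of a table `α ∈ E₂(R)` comes with SOME exact flow of `α` on some `[0,T)`
carrying TYPE I, a per-shell ACTION CEILING, an AMPLITUDE CEILING `B ν^j` with `(1+ε₀)⁻¹ ≤ ν²`, and a FIRING FLOOR
`c_f (ν²)^k` on every shell `k ∈ ℕ` — the ν = 0 analogue of WakeRatchet's crux `MinimalViscousBlowup` ⟨22743⟩, OPEN —
then the signature of `stub_eternalFromBlowup` (skeleton `9d85f4d387c689cd` of item 20206) holds verbatim.
[cite: Tao2016AveragedNS, §4 Thm. 4.2, §6.4; KochNadirashviliSereginSverak2009, Thm 1.1 ff.; cell vocabulary (`NoGlobalCascade`, `IsEternal`, `EternalSurvivingFwd`)] -/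
theorem stub_eternalFromBlowup_of_fourPinnedBlowups
    (H : ∀ R : ℝ, 1 ≤ R → ∃ εs : ℝ, 0 < εs ∧ ∀ ε₀ : ℝ, 0 < ε₀ → ε₀ ≤ εs →
      ∀ (α : (Fin 4 → Fin 4 → Fin 4 → ℤ × ℤ × ℤ → ℝ)) (X₀ : Fin 4 → ℝ),
        InTableClass R α → NoGlobalCascade ε₀ α X₀ →
        ∃ (T C A B ν cf : ℝ) (X : Fin 4 → ℤ → ℝ → ℝ), 0 < T ∧
          (∀ i n, ContDiffOn ℝ 1 (X i n) (Set.Ico 0 T)) ∧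
          (∀ i n t, 0 ≤ t → t < T → derivWithin (X i n) (Set.Ici 0) t = quadTerm ε₀ α X i n t) ∧
          (∀ (n : ℤ) (t : ℝ), 0 ≤ t → t < T → bigLam ε₀ ^ n * (T - t) * ‖shellVec X n t‖ ≤ C) ∧
          (∀ k : ℤ, IntegrableOn (fun t => ‖shellVec X k t‖) (Ico 0 T) ∧
            bigLam ε₀ ^ k * (∫ t in Ico 0 T, ‖shellVec X k t‖) ≤ A) ∧
          0 < ν ∧ (1 + ε₀)⁻¹ ≤ ν ^ 2 ∧
          (∀ (j : ℤ) (t : ℝ), 0 ≤ t → t < T → ‖shellVec X j t‖ ≤ B * ν ^ j) ∧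
          0 < cf ∧ (∀ k : ℕ, ∃ t : ℝ, 0 ≤ t ∧ t < T ∧ cf * (ν ^ 2) ^ k ≤ ‖shellVec X (k : ℤ) t‖ ^ 2)) :
    ∀ R : ℝ, 1 ≤ R → ∃ εs : ℝ, 0 < εs ∧ ∀ ε₀ : ℝ, 0 < ε₀ → ε₀ ≤ εs →
      ∀ (α : (Fin 4 → Fin 4 → Fin 4 → ℤ × ℤ × ℤ → ℝ)) (X₀ : Fin 4 → ℝ),
        Literature.Analysis.FluidPDE.TaoCascade.InTableClass R α →
        Literature.Analysis.FluidPDE.TaoCascade.NoGlobalCascade ε₀ α X₀ →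
        ∃ W : ℤ → ℝ → Literature.Analysis.FluidPDE.TaoCascade.Em 4,
          Literature.Analysis.FluidPDE.TaoCascade.IsEternal ε₀ α W ∧
          Literature.Analysis.FluidPDE.TaoCascade.EternalSurvivingFwd 1 ε₀ W := by
  intro R hR
  obtain ⟨εs, hεs, hH⟩ := H R hR
  refine ⟨εs, hεs, fun ε₀ hε hεle α X₀ hα hNG => ?_⟩
  obtain ⟨T, C, A, B, ν, cf, X, hT, hC1, hmot, htypeI, hact, hν, hν1, hamp, hcf, hfire⟩ :=
    hH ε₀ hε hεle α X₀ hα hNG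
  obtain ⟨W, hW, -, hS⟩ := eternal_surviving_one_of_fourPinned hε hT hC1 hmot htypeI hact hν hν1 hamp hcf hfire
  exact ⟨W, hW, hS⟩

end BlowupRigidityOne

end Summit.NavierStokesRegularity.NavierStokesRegularity.Theorems

end
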